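import Summits.ValiantsHypothesis.ValiantsHypothesis.Theorems.KPlusLogSqLawTropicalBSplitDefs
import Summits.ValiantsHypothesis.ValiantsHypothesis.Theorems.KPlusLogSqLawTropicalBSplitGlue

/-!
# Route `KPlusLogSqLaw`, crux `TropicalB` — column split of a design, II: the SPLIT INEQUALITY

HONEST FRAMING.  Helper file toward the registered stubs `stub_tropThin` / `stub_tropFat` of
`Cruxes/TropicalB/Lines/birth.lean` (crux `Summit.ValiantsHypothesis.ValiantsHypothesis.Theses.KPlusLogSqLaw.TropicalB`,
ledger item `stmt-ValiantsHypothesis-19771`, route `KPlusLogSqLaw`, DRAFT; cell `pub-symmetroid`, seat `val-sym-trop-p1`,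
2026-08-26).  Nothing here proves any part of a stub; nothing asserts `TropicalB`, `KPlusLogSqLaw`, `MatrixDescartes`
or anything about `VP ≠ VNP`.

THE SPLIT INEQUALITY (a Gusfield-type decomposition bound, [folklore]: Gusfield 1980 for parametric shortest paths;
Hrubeš–Yehudayoff 2021, Prop. 23, upper half, for Birkhoff shadows).  Split the columns of a design of format `c + e`
into the blocks `castAdd e (Fin c)` and `natAdd c (Fin e)`.  The STATE of a Leibniz term is the set `R` of rows used by
the first block.  For a family `𝓡` of `c`-sets containing the state of every present term, if for each `R ∈ 𝓡` the
design restricted to (rows `R` increasing, first column block) has unsigned row bound `B₁` and the design restricted to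
(rows outside `R` increasing, second column block) has unsigned row bound `B₂`, then

  `designRowD_split :  DesignRowD d v ε (#𝓡 · (B₁ + B₂ + 1) − 1)`.

Proof.  Along an unsigned dominant chain the terms are pairwise distinct (slopes strictly increase).  Fix a state `R`;
the chain terms of state `R` are glued from pairs `(Aₖ, Bₖ)` of restricted terms (part I, `exists_halves`), each half
dominant in its restricted design at the same slope (`isDominant_halves_of_glue`).  Hence `k ↦ slope Aₖ` and
`k ↦ slope Bₖ` are both non-decreasing along the fiber and at every step at least one increases strictly
(`card_le_of_two_labels`: such a fiber has at most `#values₁ + #values₂ − 1` elements), while the number of distinct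
values of `slope Aₖ` is at most `B₁ + 1` because representatives of the values form an unsigned dominant chain of the
first restricted design (`card_image_slope_le`).  Summing over `R ∈ 𝓡` gives the bound.  With `𝓡 = all c-subsets` this is
the halving inequality `T(c+e) + 1 ≤ C(c+e, c)·(T(c) + T(e) + 1)` (companion file); with Hessenberg support only `c + 1`
states occur and the recursion is quasi-polynomial (companion file).
-/

set_option linter.dupNamespace false
set_option autoImplicit false

namespace Summit.ValiantsHypothesis.ValiantsHypothesis.Theorems.KPlusLogSqLaw

open Summit.ValiantsHypothesis.ValiantsHypothesis.Theorems.MatrixDescartes.Negative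
open Summit.ValiantsHypothesis.ValiantsHypothesis.Theorems.LacunarySymmetroidMatrixDescartes
open Summit.ValiantsHypothesis.ValiantsHypothesis.Theorems.LacunarySymmetroidMatrixDescartes.TropicalCensus
open scoped BigOperators
open Finset

/-! ## 1. Two combinatorial counting lemmas -/

/-- **Two monotone labels.**  If two integer labels are non-decreasing along a finite set of indices and at every
step at least one of them increases strictly, the set has at most `#values₁ + #values₂ − 1` elements (the rank sum
`#{values₁ < s₁ k} + #{values₂ < s₂ k}` is strictly increasing). [folklore] -/
theorem card_le_of_two_labels {N : ℕ} (F : Finset (Fin (N + 1))) (s₁ s₂ : Fin (N + 1) → ℤ)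
    (hmono₁ : ∀ k ∈ F, ∀ k' ∈ F, k < k' → s₁ k ≤ s₁ k') (hmono₂ : ∀ k ∈ F, ∀ k' ∈ F, k < k' → s₂ k ≤ s₂ k')
    (hstrict : ∀ k ∈ F, ∀ k' ∈ F, k < k' → s₁ k < s₁ k' ∨ s₂ k < s₂ k') :
    F.card ≤ (F.image s₁).card + (F.image s₂).card - 1 := by
  classical
  set V₁ := F.image s₁ with hV₁
  set V₂ := F.image s₂ with hV₂
  set ρ : Fin (N + 1) → ℕ := fun k => (V₁.filter (· < s₁ k)).card + (V₂.filter (· < s₂ k)).card with hρ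
  have hmem₁ : ∀ k ∈ F, s₁ k ∈ V₁ := fun k hk => mem_image_of_mem s₁ hk
  have hmem₂ : ∀ k ∈ F, s₂ k ∈ V₂ := fun k hk => mem_image_of_mem s₂ hk
  have hρ_lt : ∀ k ∈ F, ρ k < V₁.card + V₂.card - 1 := by
    intro k hk
    have h1 : (V₁.filter (· < s₁ k)).card < V₁.card := by
      apply card_lt_card
      refine ⟨filter_subset _ _, fun hsub => ?_⟩
      have := (mem_filter.mp (hsub (hmem₁ k hk))).2
      exact lt_irrefl _ this
    have h2 : (V₂.filter (· < s₂ k)).card < V₂.card := by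
      apply card_lt_card
      refine ⟨filter_subset _ _, fun hsub => ?_⟩
      have := (mem_filter.mp (hsub (hmem₂ k hk))).2
      exact lt_irrefl _ this
    simp only [hρ]
    omega
  have hρ_mono : ∀ k ∈ F, ∀ k' ∈ F, k < k' → ρ k < ρ k' := by
    intro k hk k' hk' hlt
    have sub1 : V₁.filter (· < s₁ k) ⊆ V₁.filter (· < s₁ k') := by
      intro x hx
      rw [mem_filter] at hx ⊢
      exact ⟨hx.1, lt_of_lt_of_le hx.2 (hmono₁ k hk k' hk' hlt)⟩
    have sub2 : V₂.filter (· < s₂ k) ⊆ V₂.filter (· < s₂ k') := by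
      intro x hx
      rw [mem_filter] at hx ⊢
      exact ⟨hx.1, lt_of_lt_of_le hx.2 (hmono₂ k hk k' hk' hlt)⟩
    rcases hstrict k hk k' hk' hlt with h | h
    · have ss1 : V₁.filter (· < s₁ k) ⊂ V₁.filter (· < s₁ k') := by
        refine ⟨sub1, fun hsub => ?_⟩
        have hin : s₁ k ∈ V₁.filter (· < s₁ k') := mem_filter.mpr ⟨hmem₁ k hk, h⟩
        exact lt_irrefl _ (mem_filter.mp (hsub hin)).2
      have := card_lt_card ss1
      have := card_le_card sub2
      simp only [hρ]
      omega
    · have ss2 : V₂.filter (· < s₂ k) ⊂ V₂.filter (· < s₂ k') := by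
        refine ⟨sub2, fun hsub => ?_⟩
        have hin : s₂ k ∈ V₂.filter (· < s₂ k') := mem_filter.mpr ⟨hmem₂ k hk, h⟩
        exact lt_irrefl _ (mem_filter.mp (hsub hin)).2
      have := card_lt_card ss2
      have := card_le_card sub1
      simp only [hρ]
      omega
  have hinj : Set.InjOn ρ F := by
    intro k hk k' hk' h
    rcases lt_trichotomy k k' with hlt | heq | hgt
    · exact absurd h (ne_of_lt (hρ_mono k hk k' hk' hlt))
    · exact heq
    · exact absurd h.symm (ne_of_lt (hρ_mono k' hk' k hk hgt))
  have hmaps : Set.MapsTo ρ F (range (V₁.card + V₂.card - 1)) := by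
    intro k hk
    exact mem_coe.mpr (mem_range.mpr (hρ_lt k (mem_coe.mp hk)))
  calc F.card ≤ (range (V₁.card + V₂.card - 1)).card := card_le_card_of_injOn ρ hmaps hinj
    _ = V₁.card + V₂.card - 1 := card_range _

/-- **Distinct slopes of dominant terms.**  If the terms `A k`, `k ∈ F`, are unique optima of a design with unsigned
row bound `B` at strictly increasing slopes `θ k`, then they take at most `B + 1` distinct slope values: representatives
of the values, ordered by `k`, form an unsigned dominant chain. [folklore] -/
theorem card_image_slope_le {m K : ℕ} (d : Fin K → ℕ) (v₁ ε₁ : Fin m → Fin m → Fin K → ℤ) {B : ℕ}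
    (hD : DesignRowD d v₁ ε₁ B) {N : ℕ} (θ : Fin (N + 1) → ℤ) (hθ : StrictMono θ)
    (A : Fin (N + 1) → Equiv.Perm (Fin m) × (Fin m → Fin K)) (F : Finset (Fin (N + 1)))
    (hA : ∀ k ∈ F, IsDominant d v₁ ε₁ (θ k) (A k)) :
    (F.image fun k => TropicalCensus.slope d (A k)).card ≤ B + 1 := by
  classical
  set V := F.image fun k => TropicalCensus.slope d (A k) with hV
  -- representatives of the slope values
  have hrep : ∀ s : ℤ, ∃ k : Fin (N + 1), s ∈ V → k ∈ F ∧ TropicalCensus.slope d (A k) = s := by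
    intro s
    by_cases hs : s ∈ V
    · obtain ⟨k, hk, hks⟩ := mem_image.mp hs
      exact ⟨k, fun _ => ⟨hk, hks⟩⟩
    · exact ⟨0, fun h => absurd h hs⟩
  choose g hg using hrep
  set J := V.image g with hJ
  have hJF : ∀ k ∈ J, k ∈ F ∧ g (TropicalCensus.slope d (A k)) = k := by
    intro k hk
    obtain ⟨s, hs, rfl⟩ := mem_image.mp hk
    refine ⟨(hg s hs).1, ?_⟩
    rw [(hg s hs).2]
  have hJcard : J.card = V.card := by
    apply card_image_of_injOn
    intro s hs s' hs' h
    have e1 := (hg s (mem_coe.mp hs)).2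
    have e2 := (hg s' (mem_coe.mp hs')).2
    rw [← e1, ← e2, h]
  rcases Nat.eq_zero_or_pos J.card with hJ0 | hJpos
  · rw [← hJcard, hJ0]; exact Nat.zero_le _
  obtain ⟨M, hM⟩ : ∃ M, J.card = M + 1 := ⟨J.card - 1, by omega⟩
  set ι := J.orderEmbOfFin hM with hι
  have hιJ : ∀ t, ι t ∈ J := fun t => orderEmbOfFin_mem J hM t
  have hdist : ∀ t : Fin M, A (ι t.castSucc) ≠ A (ι t.succ) := by
    intro t heq
    have hlt' : t.castSucc < t.succ := Fin.castSucc_lt_succ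
    have hne : ι t.castSucc ≠ ι t.succ := fun h => hlt'.ne (ι.injective h)
    apply hne
    rw [← (hJF _ (hιJ t.castSucc)).2, ← (hJF _ (hιJ t.succ)).2, heq]
  have key := hD M (fun t => θ (ι t)) (fun t => A (ι t)) (hθ.comp ι.strictMono)
    (fun t => hA _ (hJF _ (hιJ t)).1) hdist
  rw [← hJcard, hM]
  omega

/-! ## 2. The fiber of a state -/

section Fiber

variable {c e K : ℕ} (d : Fin K → ℕ) (v ε : Fin (c + e) → Fin (c + e) → Fin K → ℤ)
  (r₁ : Fin c → Fin (c + e)) (r₂ : Fin e → Fin (c + e))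
  (v₁ ε₁ : Fin c → Fin c → Fin K → ℤ) (v₂ ε₂ : Fin e → Fin e → Fin K → ℤ)

/-- **Fiber bound.**  Along an unsigned dominant chain of the full design, the indices whose terms are glued along
`(r₁, r₂)` (first-block rows in `range r₁`, second-block rows in `range r₂`) number at most `B₁ + B₂ + 1`, where `B₁`,
`B₂` are unsigned row bounds of the two restricted designs. [folklore] -/
theorem card_fiber_le (hr₁ : Function.Injective r₁) (hr₂ : Function.Injective r₂) (hdisj : ∀ i j, r₁ i ≠ r₂ j)
    (hv₁ : ∀ i j l, v₁ i j l = v (r₁ i) (Fin.castAdd e j) l) (hε₁ : ∀ i j l, ε₁ i j l = ε (r₁ i) (Fin.castAdd e j) l)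
    (hv₂ : ∀ i j l, v₂ i j l = v (r₂ i) (Fin.natAdd c j) l) (hε₂ : ∀ i j l, ε₂ i j l = ε (r₂ i) (Fin.natAdd c j) l)
    {B₁ B₂ : ℕ} (hD₁ : DesignRowD d v₁ ε₁ B₁) (hD₂ : DesignRowD d v₂ ε₂ B₂)
    {N : ℕ} (θ : Fin (N + 1) → ℤ) (p : Fin (N + 1) → Equiv.Perm (Fin (c + e)) × (Fin (c + e) → Fin K))
    (hθ : StrictMono θ) (hdom : ∀ k, IsDominant d v ε (θ k) (p k)) (hne : ∀ k : Fin N, p k.castSucc ≠ p k.succ)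
    (F : Finset (Fin (N + 1)))
    (hran : ∀ k ∈ F, (∀ j, ∃ i, r₁ i = (p k).1 (Fin.castAdd e j)) ∧ (∀ j, ∃ i, r₂ i = (p k).1 (Fin.natAdd c j))) :
    F.card ≤ B₁ + B₂ + 1 := by
  classical
  have hinj : Function.Injective p := injective_of_chainD d v ε θ p hθ hdom hne
  -- halves of the fiber terms
  have hex : ∀ k, ∃ AB : (Equiv.Perm (Fin c) × (Fin c → Fin K)) × (Equiv.Perm (Fin e) × (Fin e → Fin K)),
      k ∈ F → (∀ j, (p k).1 (Fin.castAdd e j) = r₁ (AB.1.1 j)) ∧ (∀ j, (p k).1 (Fin.natAdd c j) = r₂ (AB.2.1 j)) ∧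
        (∀ j, (p k).2 (Fin.castAdd e j) = AB.1.2 j) ∧ (∀ j, (p k).2 (Fin.natAdd c j) = AB.2.2 j) := by
    intro k
    by_cases hk : k ∈ F
    · obtain ⟨A, B, h1, h2, h3, h4⟩ := exists_halves r₁ r₂ (p k) (hran k hk).1 (hran k hk).2
      exact ⟨(A, B), fun _ => ⟨h1, h2, h3, h4⟩⟩
    · exact ⟨((1, fun j => (p k).2 (Fin.castAdd e j)), (1, fun j => (p k).2 (Fin.natAdd c j))),
        fun h => absurd h hk⟩
  choose AB hAB using hex
  set A : Fin (N + 1) → Equiv.Perm (Fin c) × (Fin c → Fin K) := fun k => (AB k).1 with hAdef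
  set B : Fin (N + 1) → Equiv.Perm (Fin e) × (Fin e → Fin K) := fun k => (AB k).2 with hBdef
  -- the halves are dominant in the restricted designs
  have hdomAB : ∀ k ∈ F, IsDominant d v₁ ε₁ (θ k) (A k) ∧ IsDominant d v₂ ε₂ (θ k) (B k) := by
    intro k hk
    obtain ⟨h1, h2, h3, h4⟩ := hAB k hk
    exact isDominant_halves_of_glue d v ε r₁ r₂ v₁ ε₁ v₂ ε₂ hr₁ hr₂ hdisj hv₁ hε₁ hv₂ hε₂ (p k) (A k) (B k)
      h1 h2 h3 h4 (hdom k)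
  -- the two slope labels
  set s₁ : Fin (N + 1) → ℤ := fun k => TropicalCensus.slope d (A k) with hs₁
  set s₂ : Fin (N + 1) → ℤ := fun k => TropicalCensus.slope d (B k) with hs₂
  have hA_lt : ∀ k ∈ F, ∀ k' ∈ F, k < k' → A k ≠ A k' → s₁ k < s₁ k' := fun k hk k' hk' hlt hne' =>
    slope_lt_of_dominant d v₁ ε₁ (hθ hlt) hne' (hdomAB k hk).1 (hdomAB k' hk').1
  have hB_lt : ∀ k ∈ F, ∀ k' ∈ F, k < k' → B k ≠ B k' → s₂ k < s₂ k' := fun k hk k' hk' hlt hne' =>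
    slope_lt_of_dominant d v₂ ε₂ (hθ hlt) hne' (hdomAB k hk).2 (hdomAB k' hk').2
  have hmono₁ : ∀ k ∈ F, ∀ k' ∈ F, k < k' → s₁ k ≤ s₁ k' := by
    intro k hk k' hk' hlt
    by_cases h : A k = A k'
    · simp only [hs₁, h]; exact le_rfl
    · exact (hA_lt k hk k' hk' hlt h).le
  have hmono₂ : ∀ k ∈ F, ∀ k' ∈ F, k < k' → s₂ k ≤ s₂ k' := by
    intro k hk k' hk' hlt
    by_cases h : B k = B k'
    · simp only [hs₂, h]; exact le_rfl
    · exact (hB_lt k hk k' hk' hlt h).le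
  have hstrict : ∀ k ∈ F, ∀ k' ∈ F, k < k' → s₁ k < s₁ k' ∨ s₂ k < s₂ k' := by
    intro k hk k' hk' hlt
    by_cases hA' : A k = A k'
    · by_cases hB' : B k = B k'
      · -- both halves agree: the full terms agree, contradicting injectivity
        exfalso
        obtain ⟨h1, h2, h3, h4⟩ := hAB k hk
        obtain ⟨h1', h2', h3', h4'⟩ := hAB k' hk'
        have hpp : p k = p k' := by
          refine eq_of_glue_of_glue r₁ r₂ (p k) (p k') (A k) (B k) h1 h2 h3 h4 ?_ ?_ ?_ ?_
          · intro j; rw [hA']; exact h1' j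
          · intro j; rw [hB']; exact h2' j
          · intro j; rw [hA']; exact h3' j
          · intro j; rw [hB']; exact h4' j
        exact (ne_of_lt hlt) (hinj hpp)
      · exact Or.inr (hB_lt k hk k' hk' hlt hB')
    · exact Or.inl (hA_lt k hk k' hk' hlt hA')
  have hcard := card_le_of_two_labels F s₁ s₂ hmono₁ hmono₂ hstrict
  have hV₁ := card_image_slope_le d v₁ ε₁ hD₁ θ hθ A F (fun k hk => (hdomAB k hk).1)
  have hV₂ := card_image_slope_le d v₂ ε₂ hD₂ θ hθ B F (fun k hk => (hdomAB k hk).2)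
  have e1 : (F.image s₁) = F.image fun k => TropicalCensus.slope d (A k) := rfl
  have e2 : (F.image s₂) = F.image fun k => TropicalCensus.slope d (B k) := rfl
  rw [e1, e2] at hcard
  omega

end Fiber

/-! ## 3. The split inequality -/

section Split

variable {c e K : ℕ}

/-- the two column blocks of `Fin (c + e)` are disjoint. [folklore] -/
theorem castAdd_ne_natAdd (j : Fin c) (j' : Fin e) : Fin.castAdd e j ≠ Fin.natAdd c j' := by
  intro h
  have := congrArg Fin.val h
  simp only [Fin.val_castAdd, Fin.val_natAdd] at this
  omega

/-- **The split inequality.**  Let `𝓡` be a family of `c`-subsets of the rows of a design of format `c + e` containing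
the first-block row set of every present term.  If for every `R ∈ 𝓡` the restriction to (rows of `R`, increasing;
columns of the first block) has unsigned row bound `B₁` and the restriction to (rows outside `R`, increasing; columns of
the second block) has unsigned row bound `B₂`, then the design has unsigned row bound `#𝓡·(B₁ + B₂ + 1) − 1`.
[folklore: Gusfield 1980 (paths) / Hrubeš–Yehudayoff 2021 Prop. 23 (Birkhoff shadows), in the dominance vocabulary] -/
theorem designRowD_split (d : Fin K → ℕ) (v ε : Fin (c + e) → Fin (c + e) → Fin K → ℤ)
    (𝓡 : Finset (Finset (Fin (c + e)))) (h𝓡 : ∀ R ∈ 𝓡, R.card = c) {B₁ B₂ : ℕ}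
    (h₁ : ∀ R ∈ 𝓡, ∀ r : Fin c ↪o Fin (c + e), (∀ i, r i ∈ R) →
      DesignRowD d (fun i j l => v (r i) (Fin.castAdd e j) l) (fun i j l => ε (r i) (Fin.castAdd e j) l) B₁)
    (h₂ : ∀ R ∈ 𝓡, ∀ r : Fin e ↪o Fin (c + e), (∀ i, r i ∉ R) →
      DesignRowD d (fun i j l => v (r i) (Fin.natAdd c j) l) (fun i j l => ε (r i) (Fin.natAdd c j) l) B₂)
    (hst : ∀ q : Equiv.Perm (Fin (c + e)) × (Fin (c + e) → Fin K), termSign ε q ≠ 0 →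
      (univ.image fun j : Fin c => q.1 (Fin.castAdd e j)) ∈ 𝓡) :
    DesignRowD d v ε (𝓡.card * (B₁ + B₂ + 1) - 1) := by
  classical
  intro n θ p hθ hdom hne
  set st : Fin (n + 1) → Finset (Fin (c + e)) := fun k => univ.image fun j : Fin c => (p k).1 (Fin.castAdd e j)
    with hst_def
  have hstk : ∀ k, st k ∈ 𝓡 := fun k => hst (p k) (hdom k).1
  -- fiber bound for each state
  have hfib : ∀ R ∈ 𝓡, (univ.filter fun k => st k = R).card ≤ B₁ + B₂ + 1 := by
    intro R hR
    have hRc : R.card = c := h𝓡 R hR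
    have hRcc : Rᶜ.card = e := by rw [card_compl, Fintype.card_fin, hRc]; omega
    set r₁ : Fin c ↪o Fin (c + e) := R.orderEmbOfFin hRc with hr₁def
    set r₂ : Fin e ↪o Fin (c + e) := Rᶜ.orderEmbOfFin hRcc with hr₂def
    have hr₁mem : ∀ i, r₁ i ∈ R := fun i => orderEmbOfFin_mem R hRc i
    have hr₂mem : ∀ i, r₂ i ∉ R := fun i => mem_compl.mp (orderEmbOfFin_mem Rᶜ hRcc i)
    have hdisj : ∀ i j, r₁ i ≠ r₂ j := fun i j h => hr₂mem j (h ▸ hr₁mem i)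
    have hran₁ : ∀ x ∈ R, ∃ i, r₁ i = x := by
      intro x hx
      have : x ∈ Set.range (R.orderEmbOfFin hRc) := by rw [range_orderEmbOfFin]; exact mem_coe.mpr hx
      exact this
    have hran₂ : ∀ x ∈ Rᶜ, ∃ i, r₂ i = x := by
      intro x hx
      have : x ∈ Set.range (Rᶜ.orderEmbOfFin hRcc) := by rw [range_orderEmbOfFin]; exact mem_coe.mpr hx
      exact this
    refine card_fiber_le d v ε r₁ r₂ _ _ _ _ r₁.injective r₂.injective hdisj
      (fun _ _ _ => rfl) (fun _ _ _ => rfl) (fun _ _ _ => rfl) (fun _ _ _ => rfl)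
      (h₁ R hR r₁ hr₁mem) (h₂ R hR r₂ hr₂mem) θ p hθ hdom hne _ ?_
    intro k hk
    have hk' : st k = R := (mem_filter.mp hk).2
    refine ⟨fun j => hran₁ _ ?_, fun j => hran₂ _ ?_⟩
    · rw [← hk']
      exact mem_image_of_mem _ (mem_univ j)
    · rw [mem_compl, ← hk']
      intro hmem
      obtain ⟨j', _, hj'⟩ := mem_image.mp hmem
      exact castAdd_ne_natAdd j' j ((p k).1.injective hj')
  -- count
  have hcount : n + 1 ≤ 𝓡.card * (B₁ + B₂ + 1) := by
    calc n + 1 = (univ : Finset (Fin (n + 1))).card := by simp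
      _ = ∑ R ∈ 𝓡, ((univ : Finset (Fin (n + 1))).filter fun k => st k = R).card :=
          card_eq_sum_card_fiberwise fun k _ => hstk k
      _ ≤ ∑ _R ∈ 𝓡, (B₁ + B₂ + 1) := sum_le_sum hfib
      _ = 𝓡.card * (B₁ + B₂ + 1) := by rw [sum_const, smul_eq_mul]
  omega

end Split

end Summit.ValiantsHypothesis.ValiantsHypothesis.Theorems.KPlusLogSqLaw
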